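/-
Cell b2b-lgcu-borel (gen 27).  VALUE = THEOREM (a structural law on every hypothetical witness of
the crux, all levels `k`), NOT summit progress; the crux item `SubgroupIdentityDesigns`
(stmt-MatrixMultiplication-14079) stays open and untouched.
-/
import Mathlib
import Summits.MatrixMultiplication.MatrixMultiplication.Theorems.SubgroupIdentityDesigns.Negative.FreeModuleLaw
import Summits.MatrixMultiplication.MatrixMultiplication.Theorems.SubgroupIdentityDesigns.Negative.LevelOneInvariantDim
import Summits.MatrixMultiplication.MatrixMultiplication.Theorems.SubgroupIdentityDesigns.Negative.ScalarLaw
import Summits.MatrixMultiplication.MatrixMultiplication.Theorems.SubgroupIdentityDesigns.Negative.ScalarBlockLaw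

/-!
# Mode orbits bound the invariants of `F_k`; the scalar block law at every level

Route `LevelGradedCohnUmans`, crux `SubgroupIdentityDesigns` (stmt-MatrixMultiplication-14079),
negative side; report `run/shared/lean/b2b/levelgraded-cu/ORACLE-g27.md` §G27-9.  VALUE = THEOREM,
NOT summit progress; the crux item is untouched and remains open.

## Mode orbits (all `p`, `m`, `k`, every `K ≤ GL_m(𝔽_p)`)

Right translation by `κ` sends the mode character `ψ_M : g ↦ ψ(tr(M g))` to `ψ_{κ M}`
(`tr(M g κ) = tr(κ M g)`, `char_mul_right`), so `K` acts on the MODES `{M : rk M ≤ k}` by left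
multiplication and the right `K`-average `Σ_{κ ∈ K} ψ_{κ M}` of `ψ_M` only depends on the `K`-orbit
of `M`.  Averaging a right-`K`-invariant `f ∈ F_k` reproduces `|K| f`, hence
`dim (F_k)^K ≤ #(K-orbits on the modes)`, and for `K` SEMIREGULAR on the non-zero modes (no
`κ ≠ 1` fixes a non-zero `M` of rank `≤ k` — scalar subgroups are, `semiregular_modes_of_le_range`)
Burnside's count `#orbits · |K| + 1 = N_k + |K|` (`N_k = #{M : rk M ≤ k}`) gives

  `|K| · dim (F_k)^K + 1 ≤ N_k + |K|`   (`card_mul_finrank_invRight_le`;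
                                          the mode action is installed locally in the proof).

(At `k = 1`, `LevelOneInvariantDim` is sharper by the relations among the `ψ_M` on `GL`.)

## The scalar block law at level `k`

With the commuting-kernel law of `ScalarBlockLaw` (`|H₁||H₂| ≤ dim J^K` for `K ≤ H₃` commuting
with `H₂`; central `K ≤ H₁`, `K ≤ H₂` likewise): every level-`k` witness of the crux in `GL_m(𝔽_p)`
(subgroup TPP + the design clause verbatim) satisfies, for each member `Hᵢ` and each scalar
subgroup `K ≤ Hᵢ` of order `s`,

  `s · Π_{j ≠ i} |H_j| + 1 ≤ N_k + s`,  i.e.  `Π_{j ≠ i} |H_j| ≤ 1 + (N_k − 1)/s`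

(`scalar_block_law_level_right/left/middle`): the interpolation budget `N_k` of the two other
members is divided by the order of the scalar part of the third.  The level-one census evaluation
is in `ScalarBlockLaw` / ORACLE-g27 §G27-8; this file is the all-`k` structural form.

Sorry-free; standard axioms.
-/

set_option linter.dupNamespace false

noncomputable section

open scoped BigOperators Classical Matrix
open Module (finrank)

namespace Summit.MatrixMultiplication.MatrixMultiplication.Theorems.SubgroupIdentityDesigns.Negative
namespace ScalarBlockLevel

open Literature.Barriers.MatrixMultiplication (SubgroupTPP)
open Summit.MatrixMultiplication.MatrixMultiplication.Theorems.LieRankDesigns.Negative (GLm Mat)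
open Summit.MatrixMultiplication.MatrixMultiplication.Theorems.LevelOneGL2Designs.Negative
  (levelMap levelSubmodule readout)
open FreeModuleLaw (invRight mem_invRight invRight_le)
open LevelOneInvariantDim (avgR avgR_apply avgR_of_mem_invRight mem_of_avgR_mem)

variable {p m : ℕ} [hp : Fact p.Prime] {k : ℕ}

/-! ## Mode characters under right translation -/

/-- `ψ_M (g κ) = ψ_{κ M} (g)`: right translation acts on mode characters through left
multiplication of the mode. -/
theorem char_mul_right (M : Mat p m) (g κ : GLm p m) :
    ZMod.stdAddChar (Matrix.trace (M * ((g * κ : GLm p m) : Mat p m))) =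
      ZMod.stdAddChar (Matrix.trace ((κ : Mat p m) * M * (g : Mat p m))) := by
  rw [Units.val_mul, ← Matrix.mul_assoc, Matrix.trace_mul_comm, Matrix.mul_assoc]

/-- Unfolding `levelMap`: `c ↦ Σ_{rk M ≤ k} c_M ψ_M`. -/
theorem levelMap_apply (c : {M : Mat p m // M.rank ≤ k} → ℂ) (g : GLm p m) :
    levelMap p m k c g = ∑ M : {M : Mat p m // M.rank ≤ k},
      c M * ZMod.stdAddChar (Matrix.trace (M.1 * (g : Mat p m))) := rfl

/-- The right `K`-average of a level-`k` function is the corresponding combination of the averaged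
mode characters `Σ_{κ ∈ K} ψ_{κ M}`. -/
theorem avgR_levelMap (K : Subgroup (GLm p m)) (c : {M : Mat p m // M.rank ≤ k} → ℂ) :
    avgR K (levelMap p m k c) = fun g : GLm p m => ∑ M : {M : Mat p m // M.rank ≤ k},
      c M * ∑ κ : K, ZMod.stdAddChar
        (Matrix.trace (((κ : GLm p m) : Mat p m) * M.1 * (g : Mat p m))) := by
  funext g
  rw [avgR_apply]
  simp only [levelMap_apply, Finset.mul_sum, char_mul_right]
  exact Finset.sum_comm

/-! ## The orbit count -/

/-- **MODE-ORBIT BOUND, semiregular evaluation.**  For every level `k` and every subgroup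
`K ≤ GL_m(𝔽_p)` no non-identity element of which fixes a non-zero matrix of rank `≤ k` under left
multiplication: `|K| · dim (F_k)^K + 1 ≤ N_k + |K|`, `N_k = #{M : rk M ≤ k}`.  (In general
`dim (F_k)^K ≤ #(K-orbits on the modes)`; the orbit space is only used inside the proof.) -/
theorem card_mul_finrank_invRight_le (K : Subgroup (GLm p m))
    (hK : ∀ κ : K, ∀ M : Mat p m, M.rank ≤ k → M ≠ 0 →
      ((κ : GLm p m) : Mat p m) * M = M → κ = 1) :
    Nat.card K * finrank ℂ (invRight K (levelSubmodule p m k)) + 1 ≤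
      Fintype.card {M : Mat p m // M.rank ≤ k} + Nat.card K := by
  -- the left action of `GL_m(𝔽_p)` (hence of `K`) on the modes
  letI inst : MulAction (GLm p m) {M : Mat p m // M.rank ≤ k} :=
    { smul := fun g M => ⟨(g : Mat p m) * M.1, (Matrix.rank_mul_le_right _ _).trans M.2⟩
      one_smul := fun M => Subtype.ext (by
        show ((1 : GLm p m) : Mat p m) * M.1 = M.1
        simp)
      mul_smul := fun g h M => Subtype.ext (by
        show ((g * h : GLm p m) : Mat p m) * M.1 = (g : Mat p m) * ((h : Mat p m) * M.1)
        simp [Matrix.mul_assoc]) }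
  have hsmul : ∀ (κ : K) (M : {M : Mat p m // M.rank ≤ k}),
      ((κ • M : {M : Mat p m // M.rank ≤ k}) : Mat p m) = ((κ : GLm p m) : Mat p m) * M.1 :=
    fun _ _ => rfl
  -- the averaged mode characters and their orbit invariance
  let Φ : {M : Mat p m // M.rank ≤ k} → (GLm p m → ℂ) := fun M g =>
    ∑ κ : K, ZMod.stdAddChar (Matrix.trace (((κ : GLm p m) : Mat p m) * M.1 * (g : Mat p m)))
  have hΦ : ∀ (M : {M : Mat p m // M.rank ≤ k}) (g : GLm p m), Φ M g =
      ∑ κ : K, ZMod.stdAddChar (Matrix.trace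
        (((κ • M : {M : Mat p m // M.rank ≤ k}) : Mat p m) * (g : Mat p m))) := fun M g => rfl
  have hΦsmul : ∀ (κ₀ : K) (M : {M : Mat p m // M.rank ≤ k}), Φ (κ₀ • M) = Φ M := by
    intro κ₀ M
    funext g
    rw [hΦ, hΦ]
    exact Fintype.sum_equiv (Equiv.mulRight κ₀) _ _ fun κ => by
      simp only [Equiv.coe_mulRight, mul_smul]
  let R := MulAction.orbitRel K {M : Mat p m // M.rank ≤ k}
  have hΦout : ∀ M : {M : Mat p m // M.rank ≤ k},
      Φ M = Φ (Quotient.out (Quotient.mk R M)) := by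
    intro M
    obtain ⟨κ, hκ⟩ := MulAction.mem_orbit_iff.1 (MulAction.orbitRel_apply.1 (Quotient.exact
      (Quotient.out_eq (Quotient.mk R M))))
    rw [← hκ, hΦsmul]
  -- `(F_k)^K ≤ span {Φ ω.out}`
  have hle : invRight K (levelSubmodule p m k) ≤
      Submodule.span ℂ (Set.range fun ω : Quotient R => Φ ω.out) := by
    intro f hf
    have hfJ : f ∈ levelSubmodule p m k := invRight_le K _ hf
    obtain ⟨c, rfl⟩ := (LinearMap.mem_range).1 hfJ
    refine mem_of_avgR_mem hf ?_
    have havg : avgR K (levelMap p m k c) = ∑ M : {M : Mat p m // M.rank ≤ k}, c M • Φ M := by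
      rw [avgR_levelMap]
      funext g
      simp only [Finset.sum_apply, Pi.smul_apply, smul_eq_mul, Φ]
    rw [havg]
    refine Submodule.sum_mem _ fun M _ => Submodule.smul_mem _ _ ?_
    rw [hΦout M]
    exact Submodule.subset_span ⟨_, rfl⟩
  have hdim : finrank ℂ (invRight K (levelSubmodule p m k)) ≤ Fintype.card (Quotient R) :=
    (Submodule.finrank_mono hle).trans (finrank_range_le_card _)
  -- Burnside for the semiregular action
  have hB := MulAction.sum_card_fixedBy_eq_card_orbits_mul_card_group K {M : Mat p m // M.rank ≤ k}
  have hfix1 : Fintype.card (MulAction.fixedBy {M : Mat p m // M.rank ≤ k} (1 : K)) =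
      Fintype.card {M : Mat p m // M.rank ≤ k} := by
    have e : MulAction.fixedBy {M : Mat p m // M.rank ≤ k} (1 : K) ≃ {M : Mat p m // M.rank ≤ k} :=
      Equiv.subtypeUnivEquiv fun M => by simp
    rw [Fintype.card_congr e]
  let Z : {M : Mat p m // M.rank ≤ k} := ⟨0, by simp⟩
  have hfix : ∀ κ : K, κ ≠ 1 →
      Fintype.card (MulAction.fixedBy {M : Mat p m // M.rank ≤ k} κ) = 1 := by
    intro κ hκ
    rw [Fintype.card_eq_one_iff]
    refine ⟨⟨Z, ?_⟩, fun M => Subtype.ext ?_⟩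
    · rw [MulAction.mem_fixedBy]
      exact Subtype.ext (by simp [hsmul, Z])
    · by_contra hM
      have hM0 : (M.1 : {M : Mat p m // M.rank ≤ k}).1 ≠ 0 := fun h => hM (Subtype.ext h)
      have hfixed : κ • (M.1 : {M : Mat p m // M.rank ≤ k}) = M.1 := M.2
      exact hκ (hK κ M.1.1 M.1.2 hM0 (by rw [← hsmul]; exact congr_arg Subtype.val hfixed))
  have hsum : (∑ κ : K, Fintype.card (MulAction.fixedBy {M : Mat p m // M.rank ≤ k} κ)) =
      Fintype.card {M : Mat p m // M.rank ≤ k} + (Fintype.card K - 1) := by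
    rw [← Finset.add_sum_erase _ _ (Finset.mem_univ (1 : K)), hfix1]
    congr 1
    rw [Finset.sum_congr rfl fun κ hκ => hfix κ (Finset.ne_of_mem_erase hκ), Finset.sum_const,
      Finset.card_erase_of_mem (Finset.mem_univ _), Finset.card_univ, smul_eq_mul, mul_one]
  rw [hsum] at hB
  have hB' : Fintype.card {M : Mat p m // M.rank ≤ k} + (Fintype.card K - 1) =
      Fintype.card (Quotient R) * Fintype.card K := hB
  rw [Nat.card_eq_fintype_card]
  have hpos : 1 ≤ Fintype.card K := Fintype.card_pos
  have h1 := Nat.mul_le_mul_left (Fintype.card K) hdim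
  rw [Nat.mul_comm (Fintype.card (Quotient R))] at hB'
  omega

/-- A subgroup of scalar matrices is semiregular on the non-zero matrices (of any rank). -/
theorem semiregular_modes_of_le_range {K : Subgroup (GLm p m)} (hKZ : K ≤ (scalarHom p m).range) :
    ∀ κ : K, ∀ M : Mat p m, M.rank ≤ k → M ≠ 0 → ((κ : GLm p m) : Mat p m) * M = M → κ = 1 := by
  intro κ M _ hM hκM
  obtain ⟨u, hu⟩ := hKZ κ.2
  obtain ⟨i, j, hij⟩ : ∃ i j, M i j ≠ 0 := by
    by_contra h
    push Not at h
    exact hM (Matrix.ext fun i j => by simpa using h i j)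
  have hentry := congr_fun (congr_fun hκM i) j
  rw [← hu, coe_scalarHom, Matrix.scalar_apply, Matrix.diagonal_mul] at hentry
  have hu1 : (u : ZMod p) = 1 := (mul_left_eq_self₀.1 hentry).resolve_right hij
  have hu1' : u = 1 := Units.ext hu1
  apply Subtype.ext
  rw [← hu, hu1', map_one]
  rfl

/-! ## The scalar block law at level `k` -/

section Law

open Summit.MatrixMultiplication.MatrixMultiplication.Theorems.LevelOneGL2Designs.Negative
  (levelSubmodule_bi_inv)
open PackingBridge (exists_test)
open ScalarBlockLaw (card_mul_le_finrank_invRight_right card_mul_le_finrank_invRight_left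
  card_mul_le_finrank_invRight_middle central_of_le_range)

/-- **THE SCALAR BLOCK LAW AT LEVEL `k` (right form).**  For every level-`k` witness of
`SubgroupIdentityDesigns` in `GL_m(𝔽_p)` and every scalar subgroup `K ≤ H₃`:
`|K| · |H₁| |H₂| + 1 ≤ N_k + |K|`, `N_k = #{M : rk M ≤ k}`. -/
theorem scalar_block_law_level_right {H₁ H₂ H₃ : Subgroup (GLm p m)}
    (htpp : SubgroupTPP H₁ H₂ H₃)
    (hdes : ∃ c : Mat p m → ℂ, (∀ M, k < M.rank → c M = 0) ∧
      (∑ M, c M * ZMod.stdAddChar (Matrix.trace (M * ((1 : GLm p m) : Mat p m)))) = 1 ∧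
      ∀ a ∈ H₁, ∀ b ∈ H₂, ∀ g ∈ H₃, a * b * g ≠ 1 →
        (∑ M, c M * ZMod.stdAddChar (Matrix.trace (M * ((a * b * g : GLm p m) : Mat p m)))) = 0)
    {K : Subgroup (GLm p m)} (hK : K ≤ H₃) (hKZ : K ≤ (scalarHom p m).range) :
    Nat.card K * (Nat.card H₁ * Nat.card H₂) + 1 ≤
      Fintype.card {M : Mat p m // M.rank ≤ k} + Nat.card K := by
  obtain ⟨f, hf, h1, h0⟩ := exists_test hdes
  have hxy := card_mul_le_finrank_invRight_right (levelSubmodule p m k) levelSubmodule_bi_inv htpp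
    hf h1 h0 hK fun κ hκ b _ => central_of_le_range hKZ κ hκ b
  have hdim := card_mul_finrank_invRight_le (k := k) K (semiregular_modes_of_le_range hKZ)
  have := Nat.mul_le_mul_left (Nat.card K) hxy
  omega

/-- **THE SCALAR BLOCK LAW AT LEVEL `k` (left form).**  `K ≤ H₁` scalar:
`|K| · |H₂| |H₃| + 1 ≤ N_k + |K|`. -/
theorem scalar_block_law_level_left {H₁ H₂ H₃ : Subgroup (GLm p m)}
    (htpp : SubgroupTPP H₁ H₂ H₃)
    (hdes : ∃ c : Mat p m → ℂ, (∀ M, k < M.rank → c M = 0) ∧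
      (∑ M, c M * ZMod.stdAddChar (Matrix.trace (M * ((1 : GLm p m) : Mat p m)))) = 1 ∧
      ∀ a ∈ H₁, ∀ b ∈ H₂, ∀ g ∈ H₃, a * b * g ≠ 1 →
        (∑ M, c M * ZMod.stdAddChar (Matrix.trace (M * ((a * b * g : GLm p m) : Mat p m)))) = 0)
    {K : Subgroup (GLm p m)} (hK : K ≤ H₁) (hKZ : K ≤ (scalarHom p m).range) :
    Nat.card K * (Nat.card H₂ * Nat.card H₃) + 1 ≤
      Fintype.card {M : Mat p m // M.rank ≤ k} + Nat.card K := by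
  obtain ⟨f, hf, h1, h0⟩ := exists_test hdes
  have hyz := card_mul_le_finrank_invRight_left (levelSubmodule p m k) levelSubmodule_bi_inv htpp
    hf h1 h0 hK (central_of_le_range hKZ)
  have hdim := card_mul_finrank_invRight_le (k := k) K (semiregular_modes_of_le_range hKZ)
  have := Nat.mul_le_mul_left (Nat.card K) hyz
  omega

/-- **THE SCALAR BLOCK LAW AT LEVEL `k` (middle form).**  `K ≤ H₂` scalar:
`|K| · |H₁| |H₃| + 1 ≤ N_k + |K|`. -/
theorem scalar_block_law_level_middle {H₁ H₂ H₃ : Subgroup (GLm p m)}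
    (htpp : SubgroupTPP H₁ H₂ H₃)
    (hdes : ∃ c : Mat p m → ℂ, (∀ M, k < M.rank → c M = 0) ∧
      (∑ M, c M * ZMod.stdAddChar (Matrix.trace (M * ((1 : GLm p m) : Mat p m)))) = 1 ∧
      ∀ a ∈ H₁, ∀ b ∈ H₂, ∀ g ∈ H₃, a * b * g ≠ 1 →
        (∑ M, c M * ZMod.stdAddChar (Matrix.trace (M * ((a * b * g : GLm p m) : Mat p m)))) = 0)
    {K : Subgroup (GLm p m)} (hK : K ≤ H₂) (hKZ : K ≤ (scalarHom p m).range) :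
    Nat.card K * (Nat.card H₁ * Nat.card H₃) + 1 ≤
      Fintype.card {M : Mat p m // M.rank ≤ k} + Nat.card K := by
  obtain ⟨f, hf, h1, h0⟩ := exists_test hdes
  have hxz := card_mul_le_finrank_invRight_middle (levelSubmodule p m k) levelSubmodule_bi_inv htpp
    hf h1 h0 hK (central_of_le_range hKZ)
  have hdim := card_mul_finrank_invRight_le (k := k) K (semiregular_modes_of_le_range hKZ)
  have := Nat.mul_le_mul_left (Nat.card K) hxz
  omega

end Law

end ScalarBlockLevel
end Summit.MatrixMultiplication.MatrixMultiplication.Theorems.SubgroupIdentityDesigns.Negative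

end
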